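import Literature.Probability.FitznerVanDerHofstad2017.SrwWSplitHybrid
import HarnessLib

/-!
# The exact weight table of the hybrid `W`-split: `#{σ : σS ∩ S = ∅} · C(d,s) = C(d-s,s) · d!`

Literature support (Fitzner–van der Hofstad, *Mean-field behavior for nearest-neighbor percolation in `d > 10`*,
EJP 22 (2017), with the NoBLE analysis *Generalized approach to the non-backtracking lace expansion*, PTRF 169 (2017)
§3.5.3 (3.34)–(3.36) p. 1071: the symmetrised bound on the weighted bubble `W`).  The hybrid `W`-split
(`SrwWSplitHybrid`: disjoint relative placements exact, overlapping ones by product-Jensen) accepts ANY weight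
table `αQ : s ↦ α_s` with `α_{#S} · d! ≤ #{σ ∈ 𝔖_d : σS ∩ S = ∅}` (`srwW_le_hybrid_cert`, kernel hypothesis `hα` of
`SrwWSplitHybridKernel`).  The union bound gives `1 - s²/d`; this module certifies the EXACT ratio

  `#{σ : σS ∩ S = ∅} / d! = C(d-s, s) / C(d, s)`   (`s = #S`),

e.g. `28/45, 7/24, 1/14` at `d = 10`, `s = 2, 3, 4` (union bound: `3/5, 1/10, ≤ 0`).

## Proof (double counting over the fibres of `σ ↦ σS`)
`permFib S T = {σ : σS = T}`; all fibres over `s`-sets `T` are equinumerous (left multiplication by a permutation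
carrying `T` to `T'`, built with `Equiv.subtypeCongr`), say of size `M`; summing over all `s`-sets gives
`d! = C(d,s) · M`, over the `s`-subsets of `Sᶜ` gives `#{σS ∩ S = ∅} = C(d-s,s) · M`.

Contents: `permFib`, `mem_permFib`, `exists_perm_mem_iff`, `card_permFib_eq`, `sum_card_permFib`,
`card_disPerms_eq_sum`, **`card_disPerms_mul_choose`**, the table `exactAlphaQ d s = C(d-s,s)/C(d,s)` and
**`exactAlphaQ_admissible`** (the `hα` of the hybrid kernel, with equality).
Elementary combinatorics; which lane a certificate built on it belongs to is decided by the ORDERS of the build.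
-/

namespace Literature.Probability.FitznerVanDerHofstad2017

open Finset

variable {d : ℕ}

/-! ### §1. Fibres of `σ ↦ σS` -/

/-- The fibre `{σ ∈ 𝔖_d : σS = T}`. [cite: FitznerVanDerHofstad2016NoBLE, §3.5.3 (3.34) p. 1071] -/
def permFib (S T : Finset (Fin d)) : Finset (Equiv.Perm (Fin d)) :=
  univ.filter fun σ => S.image ⇑σ = T

/-- Pointwise form of `σS = T`: `σ i ∈ T ↔ i ∈ S`. [cite: FitznerVanDerHofstad2016NoBLE, §3.5.3 (3.34) p. 1071] -/
theorem mem_permFib {S T : Finset (Fin d)} {σ : Equiv.Perm (Fin d)} :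
    σ ∈ permFib S T ↔ ∀ i, σ i ∈ T ↔ i ∈ S := by
  unfold permFib
  simp only [mem_filter, mem_univ, true_and]
  constructor
  · intro h i
    constructor
    · intro hi
      rw [← h] at hi
      obtain ⟨j, hj, hji⟩ := mem_image.1 hi
      exact σ.injective hji ▸ hj
    · intro hi
      rw [← h]
      exact mem_image_of_mem _ hi
  · intro h
    ext t
    constructor
    · intro ht
      obtain ⟨j, hj, rfl⟩ := mem_image.1 ht
      exact (h j).2 hj
    · intro ht
      exact mem_image.2 ⟨σ.symm t, (h (σ.symm t)).1 (by simpa using ht), σ.apply_symm_apply t⟩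

/-- `Equiv.subtypeCongr e f` acts by `e` on `{p}` (Mathlib plumbing, stated for `simp`). [folklore] -/
private theorem subtypeCongr_apply_pos {α : Type*} {p q : α → Prop} [DecidablePred p] [DecidablePred q]
    (e : {x // p x} ≃ {x // q x}) (f : {x // ¬p x} ≃ {x // ¬q x}) (a : α) (h : p a) :
    Equiv.subtypeCongr e f a = e ⟨a, h⟩ := by
  simp [Equiv.subtypeCongr, Equiv.sumCompl_symm_apply_of_pos h]

/-- `Equiv.subtypeCongr e f` acts by `f` off `{p}` (Mathlib plumbing, stated for `simp`). [folklore] -/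
private theorem subtypeCongr_apply_neg {α : Type*} {p q : α → Prop} [DecidablePred p] [DecidablePred q]
    (e : {x // p x} ≃ {x // q x}) (f : {x // ¬p x} ≃ {x // ¬q x}) (a : α) (h : ¬p a) :
    Equiv.subtypeCongr e f a = f ⟨a, h⟩ := by
  simp [Equiv.subtypeCongr, Equiv.sumCompl_symm_apply_of_neg h]

/-- `𝔖_d` is transitive on `s`-subsets: a permutation with `τ i ∈ T' ↔ i ∈ T` exists when `#T = #T'`
(glue a bijection `T ≃ T'` with one `Tᶜ ≃ T'ᶜ`). [cite: FitznerVanDerHofstad2016NoBLE, §3.5.3 (3.34) p. 1071] -/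
theorem exists_perm_mem_iff (T T' : Finset (Fin d)) (h : T.card = T'.card) :
    ∃ τ : Equiv.Perm (Fin d), ∀ i, τ i ∈ T' ↔ i ∈ T := by
  classical
  have h1 : Fintype.card {x // x ∈ T} = Fintype.card {x // x ∈ T'} := by simp [h]
  have h2 : Fintype.card {x // x ∉ T} = Fintype.card {x // x ∉ T'} := by
    rw [Fintype.card_subtype_compl, Fintype.card_subtype_compl, h1]
  refine ⟨Equiv.subtypeCongr (Fintype.equivOfCardEq h1) (Fintype.equivOfCardEq h2), fun i => ?_⟩
  by_cases hi : i ∈ T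
  · rw [subtypeCongr_apply_pos _ _ i hi]
    exact ⟨fun _ => hi, fun _ => (Fintype.equivOfCardEq h1 ⟨i, hi⟩).2⟩
  · rw [subtypeCongr_apply_neg _ _ i hi]
    exact ⟨fun h' => absurd h' (Fintype.equivOfCardEq h2 ⟨i, hi⟩).2, fun h' => absurd h' hi⟩

/-- All fibres over equinumerous sets are equinumerous (left multiplication by the permutation of
`exists_perm_mem_iff`). [cite: FitznerVanDerHofstad2016NoBLE, §3.5.3 (3.34) p. 1071] -/
theorem card_permFib_eq (S T T' : Finset (Fin d)) (h : T.card = T'.card) :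
    (permFib S T).card = (permFib S T').card := by
  obtain ⟨τ, hτ⟩ := exists_perm_mem_iff T T' h
  refine Finset.card_bij' (fun σ _ => τ * σ) (fun σ _ => τ⁻¹ * σ) ?_ ?_ ?_ ?_
  · intro σ hσ
    rw [mem_permFib] at hσ ⊢
    intro i
    rw [Equiv.Perm.mul_apply, hτ, hσ]
  · intro σ hσ
    rw [mem_permFib] at hσ ⊢
    intro i
    have h1 : τ ((τ⁻¹ * σ) i) = σ i := by simp
    rw [← hτ, h1]
    exact hσ i
  · intro σ _
    simp [← mul_assoc]
  · intro σ _
    simp [← mul_assoc]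

/-- `Σ_{#T = s} #permFib S T = d!` (the fibres over `s`-sets partition `𝔖_d`).
[cite: FitznerVanDerHofstad2016NoBLE, §3.5.3 (3.34) p. 1071] -/
theorem sum_card_permFib (S : Finset (Fin d)) :
    ∑ T ∈ univ.powersetCard S.card, (permFib S T).card = d.factorial := by
  have h := Finset.card_eq_sum_card_fiberwise (s := (univ : Finset (Equiv.Perm (Fin d))))
    (t := univ.powersetCard S.card) (f := fun σ : Equiv.Perm (Fin d) => S.image ⇑σ) (by
      intro σ _
      simp only [Finset.mem_coe, mem_powersetCard]
      exact ⟨subset_univ _, card_image_of_injective _ σ.injective⟩)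
  rw [Finset.card_univ, Fintype.card_perm, Fintype.card_fin] at h
  rw [h]
  rfl

/-- `#{σ : σS ∩ S = ∅} = Σ_{T ⊆ Sᶜ, #T = s} #permFib S T`. [cite: FitznerVanDerHofstad2016NoBLE, §3.5.3 (3.34) p. 1071] -/
theorem card_disPerms_eq_sum (S : Finset (Fin d)) :
    (disPerms S).card = ∑ T ∈ (Sᶜ).powersetCard S.card, (permFib S T).card := by
  rw [Finset.card_eq_sum_card_fiberwise (s := disPerms S) (f := fun σ : Equiv.Perm (Fin d) => S.image ⇑σ)
    (t := (Sᶜ).powersetCard S.card) ?_]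
  · refine sum_congr rfl fun T hT => ?_
    congr 1
    ext σ
    simp only [disPerms, permFib, mem_filter, mem_univ, true_and, and_iff_right_iff_imp]
    intro himg i hi
    have hiT : σ i ∈ T := himg ▸ mem_image_of_mem _ hi
    exact mem_compl.1 ((mem_powersetCard.1 hT).1 hiT)
  · intro σ hσ
    simp only [Finset.mem_coe, disPerms, mem_filter, mem_univ, true_and] at hσ
    simp only [Finset.mem_coe, mem_powersetCard]
    refine ⟨fun t ht => ?_, card_image_of_injective _ σ.injective⟩
    obtain ⟨i, hi, rfl⟩ := mem_image.1 ht
    exact mem_compl.2 (hσ i hi)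

/-! ### §2. The count and the exact weight table -/

/-- **`#{σ : σS ∩ S = ∅} · C(d, s) = C(d - s, s) · d!`** (`s = #S`).
[cite: FitznerVanDerHofstad2016NoBLE, §3.5.3 (3.34)–(3.36) p. 1071] -/
theorem card_disPerms_mul_choose (S : Finset (Fin d)) :
    (disPerms S).card * d.choose S.card = (d - S.card).choose S.card * d.factorial := by
  set M := (permFib S S).card with hM
  have hfib : ∀ T : Finset (Fin d), T.card = S.card → (permFib S T).card = M :=
    fun T hT => card_permFib_eq S T S hT
  have h1 : d.factorial = d.choose S.card * M := by
    rw [← sum_card_permFib S, sum_congr rfl fun T hT => hfib T (mem_powersetCard.1 hT).2, sum_const,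
      card_powersetCard, card_univ, Fintype.card_fin, smul_eq_mul]
  have h2 : (disPerms S).card = (d - S.card).choose S.card * M := by
    rw [card_disPerms_eq_sum, sum_congr rfl fun T hT => hfib T (mem_powersetCard.1 hT).2, sum_const,
      card_powersetCard, Finset.card_compl, Fintype.card_fin, smul_eq_mul]
  rw [h1, h2]
  ring

/-- The exact weight table `α_s = C(d-s, s) / C(d, s)` (`= Π_{i<s} (d-s-i)/(d-i)`).
[cite: FitznerVanDerHofstad2016NoBLE, §3.5.3 (3.34) p. 1071] -/
def exactAlphaQ (d s : ℕ) : ℚ := ((d - s).choose s : ℚ) / d.choose s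

/-- **Admissibility of the exact table** (with equality): `α_{#S} · d! ≤ #{σ : σS ∩ S = ∅}` — the hypothesis `hα`
of `srwW_le_hybWBoundQ` / the hybrid `WBX` cells. [cite: FitznerVanDerHofstad2016NoBLE, §3.5.3 (3.34)–(3.36) p. 1071] -/
theorem exactAlphaQ_admissible (S : Finset (Fin d)) :
    ((exactAlphaQ d S.card : ℚ) : ℝ) * d.factorial ≤ (disPerms S).card := by
  have hsd : S.card ≤ d := by simpa using S.card_le_univ
  have hc : (0 : ℝ) < d.choose S.card := by exact_mod_cast Nat.choose_pos hsd
  have h' : ((disPerms S).card : ℝ) * d.choose S.card = (d - S.card).choose S.card * d.factorial := by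
    exact_mod_cast card_disPerms_mul_choose S
  have hα : ((exactAlphaQ d S.card : ℚ) : ℝ) = ((d - S.card).choose S.card : ℝ) / d.choose S.card := by
    simp [exactAlphaQ]
  rw [hα, div_mul_eq_mul_div, div_le_iff₀ hc, ← h']

/-- `d = 10`: the exact weights `28/45, 7/24, 1/14` (`s = 2, 3, 4`) against the union bound `3/5, 1/10, -3/5`. -/
example : exactAlphaQ 10 1 = 9 / 10 ∧ exactAlphaQ 10 2 = 28 / 45 ∧ exactAlphaQ 10 3 = 7 / 24 ∧
    exactAlphaQ 10 4 = 1 / 14 ∧ exactAlphaQ 10 5 = 1 / 252 := by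
  simp only [exactAlphaQ]
  norm_num [Nat.choose]

/-- Sanity (`d = 4`, `S = {0, 1}`): `4` permutations carry `S` into `Sᶜ`, and `4 · C(4,2) = C(2,2) · 4!`. -/
example : (disPerms ({0, 1} : Finset (Fin 4))).card = 4 := by decide +kernel

end Literature.Probability.FitznerVanDerHofstad2017
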